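import Summits.HodgeConjecture.HodgeConjecture.Theses.EndoscopicMiddleDegree
import Literature.AlgebraicGeometry.HodgeTheory.HodgeModelExistence
import Summits.HodgeConjecture.HodgeConjecture.Theorems.NikulinTwinTransportSectorComplement
import Literature.AlgebraicGeometry.Surfaces.K3PeriodSurjectivityProofs

/-!
# SHARED WORKFILE — two cruxes with the short name `SectorComplement`

The directory `Cruxes/SectorComplement/` (and this `Disproof.lean`) is shared BY DECL SHORT NAME between
* **Part I** — crux stmt-HodgeConjecture-14353, `EndoscopicMiddleDegree.SectorComplement := MiddleDegreeStep → HC`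
  (cdisprove seats gen 1–2; §§1–8 below, namespace `…Cruxes.SectorComplement.Disproof`, kept VERBATIM), and
* **Part II** — crux stmt-HodgeConjecture-13684, `NikulinTwinTransport.SectorComplement := SquareHodgeOfSqrtTwo → HC`
  (cdisprove seat refuter-cdisprove-stmt-HodgeConjecture-13684-0, 2026-08-16; §§N0–N8 at the END of the file,
  namespace `…Cruxes.SectorComplement.Disproof.NikulinTwinTransport`).
Both Theses modules are imported; each part opens only its own route namespace. Seats of either crux: EXTEND your
part, never rewrite the other (precedent: `PICKED.md`, `TRIAGE-r1-1.md` keep both items' sections).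
-/


/-!
# Disproof of `SectorComplement` — findings (cdisprove seat, crux stmt-HodgeConjecture-14353)

Crux (route `EndoscopicMiddleDegree`, sector frame, auto-crux 2026-08-16):
`SectorComplement : Prop := MiddleDegreeStep → _root_.HodgeConjecture`.

## Verdict so far: NO KILL POSSIBLE SHORT OF ¬(formal Hodge conjecture) — and even that is not enough.

Kernel-checked reductions below (all sorry-free):

1. `sectorComplement_of_hodgeConjecture : HodgeConjecture → SectorComplement` — the frame is a
   COROLLARY of the summit; hence
   `not_hodgeConjecture_of_not_sectorComplement : ¬ SectorComplement → ¬ HodgeConjecture`: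
   any refutation of this crux is a refutation of the formal summit statement itself.
2. `middleDegreeStep_of_hodgeConjecture : HodgeConjecture → MiddleDegreeStep` (the datum's field
   `UnitaryBallQuotientDatum.isSmoothProjective` feeds `HodgeConjectureFor (2(m+1)) X`, conjunct 2 at
   `p := m + 1`). Hence the EXACT content of a disproof:
   `not_sectorComplement_iff : ¬ SectorComplement ↔ MiddleDegreeStep ∧ ¬ HodgeConjecture` —
   a refuter would have to (a) PROVE the route's target MiddleDegreeStep (HC in the middle degree of
   compact arithmetic 4- and 6-ball quotients, open; not vacuous-provable either, see §3) AND
   (b) REFUTE the formal Hodge conjecture. (b) alone does not suffice; (a) alone is the provers' job.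
3. `hodgeConjecture_iff : HodgeConjecture ↔ MiddleDegreeStep ∧ SectorComplement` — the frame is
   exactly "HC minus the sector", as the planner says (declared, not claimed).

## Load-bearing analysis (hypothesis-drop)

The crux has ONE hypothesis, `MiddleDegreeStep`. Dropping it gives `SectorComplementWithoutStep :=
HodgeConjecture` (def below); `sectorComplement_false_without_step` would be `¬ HodgeConjecture` —
not provable here (and not believed). So no `_false_without_` theorem exists for this crux; the
hypothesis is load-bearing only in the bookkeeping sense `hodgeConjecture_iff`.

## Junk / vacuity probes (why no cheap model bites)

* Universes: everything is monomorphic (`SchemeOver.{0} ℂ : Type 1`, `Nonempty.{1}`,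
  `IsRationalClass.{0}`; `pp.universes` read-back in W.lean, rc 0) — no universe gap between the
  `X` of `MiddleDegreeStep` and the `⦃X⦄` of `_root_.HodgeConjecture`; item 2 type-checks.
* Vacuity of `MiddleDegreeStep` (would give (a) for free): needs `UnitaryBallQuotientDatum (2(m+1)) X`
  to be EMPTY for m = 1, 2 and every X. Mathematically such data exist (Kottwitz/Clozel compact unitary
  Shimura varieties; BMM Part 2 §1), so emptiness is false in the intended model; in the tree no
  datum is constructed, but every field is a property of the genuine `Γ\𝔹`, none is contradictory
  (checked by reading: hermitian anisotropic `H` of signature (p,1), torsion-free congruence `Γ`,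
  `unif` continuous/open/onto with `Γ·ℂˣ` fibres, holomorphic in algebraic coordinates,
  `isSmoothProjective`, special subvarieties closed of codim ≥ dim W). No `False` derivable.
* Junk refutation of the formal summit (would give (b)): `HodgeConjectureFor n X =
  Nonempty (HodgeModel n X) ∧ (rational ∧ IsOfHodgeType ⇒ algebraic)`. Degenerate X tried on paper:
  X = Spec ℂ (n = 0): `IsSmoothProjective 0` plausible, `H^{2p}(pt) = 0` for p > 0 and p = 0 is
  `hodgeConjectureFor_codim_zero` — TRUE there, no bite; X = ∅: excluded by
  `geometricallyIrreducible` (and all cohomology vanishes anyway); disconnected X: excluded likewise.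
  `IsOfHodgeType` is `∃ A : HodgeModel`, so an exotic model could only ENLARGE the Hodge classes
  (making formal HC stronger) — but exhibiting a non-algebraic class of a genuine smooth projective
  variety in Lean needs singular cohomology computations of `X(ℂ)` far outside the tree. Named facts
  are `def … : Prop` hypotheses, never axioms, so no inconsistency can be imported.
* Negatives index (`ledger negatives --problem HodgeConjecture`, 2 entries: Fermat K3 multisets,
  22×22 similitude matrices) and the barrier catalogue `Literature/Barriers/HodgeConjecture/*`
  (integral coefficients, Kähler counterexamples, exceptional classes, …) contain nothing of type
  `¬ HodgeConjecture` or bearing on a pure implication frame.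

## Natural strengthenings (none refutable either)

* `MiddleDegreeStep` with the ball-quotient hypothesis dropped (HC propagates 2m ↦ 2m+2 on every
  smooth projective 2(m+1)-fold, m ∈ {1,2}) → HC: still a corollary of HC.
* Frame with target weakened to the sector (`MiddleDegreeStep → ∀ X, Nonempty (UnitaryBallQuotientDatum
  4 X) → HodgeConjectureFor 4 X`): this is `FourfoldHodge` modulo its three classical binders; implied
  by HC.
Every strengthening that keeps `HodgeConjecture` (or a consequence of it) as conclusion is
irrefutable short of ¬HC. Recorded so that ideators do not spend a line here.


## Cycle 2 (2026-08-16, gen-2 seat) — new kernel-checked findings (§§5–8 below, all sorry-free)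

5. ANATOMY. `SectorComplement ↔ HonestOffSector ∧ Calibration` (`sectorComplement_iff_honest_and_calibration`),
   where `SectorHC` := FULL `HodgeConjectureFor (2(m+1)) X` for every X carrying a datum (m ∈ {1,2}),
   `HonestOffSector := SectorHC → HC` (HC off the sector, the planner's informal reading) and
   `Calibration := MiddleDegreeStep → SectorHC` (the ON-sector content the frame silently carries: Hodge
   models, Lefschetz (1,1), the hard-Lefschetz reduction, and — at m = 2 — HC in DEGREE 4 on 6-ball
   quotients, i.e. BMM Cor. 2 at (p, n) = (6, 2), a printed theorem that is NOT a route item).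
   `calibration_of_binders` proves Calibration from exactly these four binders; so the frame is
   "honest off-sector HC" plus four printed theorems, and `¬ HonestOffSector ↔ SectorHC ∧ ¬ HC`
   (`not_honestOffSector_iff`): even the honest part needs a formal ¬HC.
6. UNIVERSALITY READING. `SectorComplement ↔ (¬ HC → ¬ MiddleDegreeStep)` and
   `HonestOffSector ↔ (¬ HC → ¬ SectorHC)`: the crux says compact arithmetic 4- and 6-ball quotients are a
   UNIVERSAL TEST FAMILY for HC (any failure anywhere is mirrored by one on the sector) — believed only
   because HC is believed; conjecture-grade, as filed.
7. WHERE A KILL COULD COME FROM. `not_hodgeConjecture_iff_modelless_or_honest :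
   ¬ HC ↔ ModellessVariety ∨ HonestCounterexample` — a formal ¬HC is either JUNK (a smooth projective X
   with `IsEmpty (HodgeModel n X)`, the anti-vacuity conjunct failing) or HONEST (a rational Hodge class
   outside `algebraicClasses`). The junk branch is closed by the tree's named fact `nonempty_hodgeModel`
   (Serre GAGA §2 + de Rham + Hodge decomposition; `not_modellessVariety_of_fact`), whence
   `not_sectorComplement_iff_of_fact : ¬ SectorComplement ↔ MiddleDegreeStep ∧ HonestCounterexample`.
   The ONE junk world that kills the crux outright — an inhabited but model-less sector — is exhibited
   (`not_sectorComplement_of_inhabited_modelless_sector`: there the target is VACUOUSLY true because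
   `IsOfHodgeType` quantifies `∃ A : HodgeModel`, and HC fails at the datum's `isSmoothProjective`) and
   excluded by the same fact (`nonempty_hodgeModel_on_sector`). Audit of the definitional stack behind
   that fact, read symbol by symbol (no Lean-level defect found): `Order.coheight` uses Mathlib's
   `Scheme` preorder `x ≤ y ↔ y ⤳ x` (generic point on top ⇒ coheight = codimension ✓);
   `IsAnalytification` pins the complex structure (regular functions holomorphic on affine opens +
   `IsManifold 𝓘(ℂ,E) ω` atlas; conjugate/rigged atlases excluded ✓); `ComplexDeRhamIsoFamily` ranges
   over `[T2Space] [SigmaCompactSpace]` manifolds only, so the classical failure of de Rham's theorem on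
   the non-Hausdorff "ℂⁿ with doubled origin" (H²ⁿ_dR = 0 ≠ ℂ = H²ⁿ_sing) does NOT empty the family ✓;
   `MForm.inChart` pulls back along `mfderivWithin` of the inverse chart (chart-consistent smoothness) ✓;
   natural families are unique up to a scalar per degree (Thom realisation + pinch maps, on paper) so
   `∃`/`∀` over models agree ✓. Datum: `anisotropic ∧ signature (p,1) ∧ posDef elsewhere` forces F ≠ ℚ
   (Landherr/Hasse; consistent), `torsionFree ∧ ⊇ Γ(n)` forces n ≥ 3 (consistent), `le_coheight` is
   codimension in the above order (consistent with `pt_mem_specialSubvariety_iff`); no `False` derivable.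
8. GENERAL PATTERN. `not_frame_iff (T) : ¬ (T → HC) ↔ T ∧ ¬ HC`: every sector frame of the summit's
   route files (ELineTransport/EisensteinMiddleThird/GaloisSieve `SectorComplement`,
   DerivedTorelliFermat.ResidualSectorComplement, ConservativityLefschetz.AbelianComplement, …) is
   refutable only through a formal ¬HC; none is refutable today. Literature (search degraded: local FTS
   down, OpenAlex 429; S2/zbMATH/Crossref answered): no printed counterexample to the RATIONAL projective
   HC — Voisin 2002 (IMRN, doi:10.1155/s1073792802111135) is Kähler, Atiyah–Hirzebruch/Totaro/Kollár are
   integral; `ledger negatives --problem HodgeConjecture` = 2 unrelated entries.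

WHY IT RESISTS (for ideators/planners, one line): the crux is `HC ∖ sector` dressed as an implication
whose conclusion IS the summit; its negation is `MiddleDegreeStep ∧ ¬HC_formal`, and ¬HC_formal has
neither an honest witness (open problem, nothing in print) nor a junk one (stack audited above).

LANDED / FILED negative lemmas (lane `Theorems/SectorComplement/Negative/`, `--supports` this item):
cycle 1 `ReductionToSummit.lean` (in tree: `not_sectorComplement_iff`, truth table, `HC ↔ target ∧ frame`);
cycle 2 `AnatomyAndKillShape.lean` (p82348, submitted 2026-08-16: anatomy, calibration from binders, dichotomy of a
formal ¬HC, exact kill content modulo `nonempty_hodgeModel`, the junk kill world and its exclusion,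
universality reading) — importable by ideators/planners.

-- Targets: none (payload.stuck_stubs = [] at gen 2 as at gen 1; no line picked).
-/

set_option linter.dupNamespace false

namespace Summit.HodgeConjecture.HodgeConjecture.Cruxes.SectorComplement.Disproof

open Summit.HodgeConjecture.HodgeConjecture.Theses.EndoscopicMiddleDegree
open Literature.AlgebraicGeometry.HodgeTheory Literature.AlgebraicGeometry.Motives
  Literature.AlgebraicGeometry.ShimuraVarieties

/-! ## 1. The frame is a corollary of the summit -/

/-- `HC ⇒ SectorComplement`: the frame is implied by the Hodge conjecture itself (discard the
hypothesis). [folklore] -/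
theorem sectorComplement_of_hodgeConjecture (h : _root_.HodgeConjecture) : SectorComplement :=
  fun _ ↦ h

/-- Contrapositive: any disproof of the crux is a disproof of the FORMAL summit statement
`_root_.HodgeConjecture`. [folklore] -/
theorem not_hodgeConjecture_of_not_sectorComplement (h : ¬ SectorComplement) :
    ¬ _root_.HodgeConjecture :=
  fun hHC ↦ h (sectorComplement_of_hodgeConjecture hHC)

/-! ## 2. The route target is a corollary of the summit, so a disproof must also PROVE the target -/

/-- `HC ⇒ MiddleDegreeStep`: a ball-quotient datum records `IsSmoothProjective (2(m+1)) X`, and the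
second conjunct of `HodgeConjectureFor (2(m+1)) X` at `p := m + 1` is the conclusion (the inductive
hypothesis in degree `2m` is not even used). [folklore] -/
theorem middleDegreeStep_of_hodgeConjecture (h : _root_.HodgeConjecture) : MiddleDegreeStep := by
  intro m X _ _ hD _ c hc hH
  obtain ⟨D⟩ := hD
  exact (h D.isSmoothProjective).2 (m + 1) c hc hH

/-- The exact content of a refutation: `¬ SectorComplement ↔ MiddleDegreeStep ∧ ¬ HC`.
So the refuter would have to prove the (open) route target AND refute the formal summit. [folklore] -/
theorem not_sectorComplement_iff :
    ¬ SectorComplement ↔ MiddleDegreeStep ∧ ¬ _root_.HodgeConjecture := by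
  constructor
  · intro h
    by_contra h'
    exact h fun hM ↦ Classical.by_contradiction fun hHC ↦ h' ⟨hM, hHC⟩
  · rintro ⟨hM, hHC⟩ hS
    exact hHC (hS hM)

/-- Given the target, the frame IS the summit. [folklore] -/
theorem sectorComplement_iff_of_middleDegreeStep (hM : MiddleDegreeStep) :
    SectorComplement ↔ _root_.HodgeConjecture :=
  ⟨fun h ↦ h hM, fun h _ ↦ h⟩

/-! ## 3. Bookkeeping identity: HC = target ∧ frame -/

/-- `HC ↔ MiddleDegreeStep ∧ SectorComplement`: the frame is precisely "HC minus the sector"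
(declared, not claimed, D-0027 §2.1). [folklore] -/
theorem hodgeConjecture_iff :
    _root_.HodgeConjecture ↔ MiddleDegreeStep ∧ SectorComplement :=
  ⟨fun h ↦ ⟨middleDegreeStep_of_hodgeConjecture h, sectorComplement_of_hodgeConjecture h⟩,
    fun h ↦ h.2 h.1⟩

/-! ## 4. Truth table: the crux fails in exactly one world — "HC false, but only off the sector" -/

/-- Classically `SectorComplement ↔ ¬ MiddleDegreeStep ∨ HC`. Both disjuncts are open; the first
IMPLIES `¬ HC` (by `middleDegreeStep_of_hodgeConjecture`). So there are exactly two ways to PROVE the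
crux — prove HC, or REFUTE HC ON THE SECTOR (a non-algebraic rational middle-degree class on a compact
arithmetic 4- or 6-ball quotient) — and exactly one way to REFUTE it: HC fails, but every counterexample
lies off the sector. [folklore] -/
theorem sectorComplement_iff_not_step_or_hc :
    SectorComplement ↔ ¬ MiddleDegreeStep ∨ _root_.HodgeConjecture := by
  constructor
  · intro h
    by_cases hM : MiddleDegreeStep
    · exact Or.inr (h hM)
    · exact Or.inl hM
  · rintro (hM | hHC) hM'
    · exact absurd hM' hM
    · exact hHC

/-- The vacuous proof of the crux: an ON-SECTOR counterexample to HC (¬ target) proves the frame.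
(Kill criterion (i)/(iii) of the route header, read backwards: a refutation of `MiddleDegreeStep`
closes THIS item positively while breaking the route.) [folklore] -/
theorem sectorComplement_of_not_middleDegreeStep (h : ¬ MiddleDegreeStep) : SectorComplement :=
  fun hM ↦ absurd hM h

/-- … and such an on-sector counterexample is in particular a counterexample to HC. [folklore] -/
theorem not_hodgeConjecture_of_not_middleDegreeStep (h : ¬ MiddleDegreeStep) :
    ¬ _root_.HodgeConjecture :=
  fun hHC ↦ h (middleDegreeStep_of_hodgeConjecture hHC)

/-- The one refuting world, spelled out: `¬ SectorComplement` iff HC fails while the sector statement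
holds, i.e. iff `¬ HC` and every failure of HC is invisible to `MiddleDegreeStep`. Equivalent to
`not_sectorComplement_iff`; recorded in this form for ideators. [folklore] -/
theorem not_sectorComplement_iff' :
    ¬ SectorComplement ↔ ¬ _root_.HodgeConjecture ∧ MiddleDegreeStep :=
  not_sectorComplement_iff.trans and_comm

/-! ## Load-bearing analysis: dropping the only hypothesis -/

/-- The crux with its single hypothesis `MiddleDegreeStep` dropped: literally the summit.
A theorem `sectorComplement_false_without_step : ¬ SectorComplementWithoutStep` would be
`¬ HodgeConjecture`; it is NOT available (and not expected). [folklore] -/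
def SectorComplementWithoutStep : Prop :=
  _root_.HodgeConjecture

/-- The dropped-hypothesis variant unfolds to the summit (rfl), and implies the crux. [folklore] -/
theorem sectorComplement_of_withoutStep (h : SectorComplementWithoutStep) : SectorComplement :=
  sectorComplement_of_hodgeConjecture h

/-- Conversely the crux plus the target give the dropped-hypothesis variant: the hypothesis is
load-bearing exactly to the extent that `MiddleDegreeStep` is not yet a theorem. [folklore] -/
theorem withoutStep_of_sectorComplement (hS : SectorComplement) (hM : MiddleDegreeStep) :
    SectorComplementWithoutStep :=
  hS hM

/-! ## Natural strengthening: drop the ball-quotient hypothesis from the target — still a corollary of HC -/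

/-- `MiddleDegreeStep` for EVERY smooth projective `2(m+1)`-fold (no ball-quotient datum). -/
def MiddleDegreeStepAllVarieties : Prop :=
  ∀ (m : ℕ) (X : SchemeOver ℂ), 1 ≤ m → m ≤ 2 → IsSmoothProjective (2 * (m + 1)) X →
    (∀ a : complexBetti X (2 * m), IsRationalClass a →
      IsOfHodgeType (2 * (m + 1)) X (2 * m) m m a → a ∈ algebraicClasses X m) →
    ∀ c : complexBetti X (2 * (m + 1)), IsRationalClass c →
      IsOfHodgeType (2 * (m + 1)) X (2 * (m + 1)) (m + 1) (m + 1) c → c ∈ algebraicClasses X (m + 1)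

/-- The datum-free strengthening of the target is also a corollary of HC (so the strengthened frame
`MiddleDegreeStepAllVarieties → HC` is again irrefutable short of ¬HC). [folklore] -/
theorem middleDegreeStepAllVarieties_of_hodgeConjecture (h : _root_.HodgeConjecture) :
    MiddleDegreeStepAllVarieties :=
  fun m _X _ _ hX _ c hc hH ↦ (h hX).2 (m + 1) c hc hH

/-- The datum-free strengthening implies the filed target. [folklore] -/
theorem middleDegreeStep_of_allVarieties (h : MiddleDegreeStepAllVarieties) : MiddleDegreeStep := by
  intro m X h1 h2 hD hlow c hc hH
  obtain ⟨D⟩ := hD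
  exact h m X h1 h2 D.isSmoothProjective hlow c hc hH


/-! ## 5. Anatomy of the frame: honest off-sector HC ∧ on-sector calibration (cycle 2) -/

/-- FULL Hodge conjecture on the sector: `HodgeConjectureFor (2(m+1)) X` (all degrees, with the
anti-vacuity model conjunct) for every `X` carrying a `UnitaryBallQuotientDatum (2(m+1)) X`,
`m ∈ {1, 2}`. [folklore] -/
def SectorHC : Prop :=
  ∀ (m : ℕ) (X : SchemeOver ℂ), 1 ≤ m → m ≤ 2 →
    Nonempty (UnitaryBallQuotientDatum (2 * (m + 1)) X) → HodgeConjectureFor (2 * (m + 1)) X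

/-- HONEST OFF-SECTOR PART of the frame: full HC on the sector implies HC (i.e. HC off the sector —
the planner's informal reading of `SectorComplement`). [folklore] -/
def HonestOffSector : Prop :=
  SectorHC → _root_.HodgeConjecture

/-- ON-SECTOR CALIBRATION hidden in the frame: middle-degree propagation gives ALL of HC on the sector
(models, Lefschetz (1,1), hard-Lefschetz reduction, and at `m = 2` HC in degree 4 = BMM Cor. 2).
[folklore] -/
def Calibration : Prop :=
  MiddleDegreeStep → SectorHC

/-- `HC ⇒ SectorHC` (the datum records `IsSmoothProjective`). [folklore] -/
theorem sectorHC_of_hodgeConjecture (h : _root_.HodgeConjecture) : SectorHC := by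
  rintro m X - - ⟨D⟩
  exact h D.isSmoothProjective

/-- `SectorHC ⇒ MiddleDegreeStep` (take the cycle conjunct at `p := m + 1`; the inductive hypothesis in
degree `2m` is not used). [folklore] -/
theorem middleDegreeStep_of_sectorHC (h : SectorHC) : MiddleDegreeStep :=
  fun m X h1 h2 hD _ c hc hH ↦ (h m X h1 h2 hD).2 (m + 1) c hc hH

/-- ANATOMY: the frame is exactly "honest off-sector HC" together with the on-sector calibration.
[folklore] -/
theorem sectorComplement_iff_honest_and_calibration :
    SectorComplement ↔ HonestOffSector ∧ Calibration :=
  ⟨fun hS ↦ ⟨fun hSec ↦ hS (middleDegreeStep_of_sectorHC hSec),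
      fun hM ↦ sectorHC_of_hodgeConjecture (hS hM)⟩,
    fun h hM ↦ h.1 (h.2 hM)⟩

/-- Both halves are corollaries of the summit. [folklore] -/
theorem honest_and_calibration_of_hodgeConjecture (h : _root_.HodgeConjecture) :
    HonestOffSector ∧ Calibration :=
  sectorComplement_iff_honest_and_calibration.1 (sectorComplement_of_hodgeConjecture h)

/-- `HC ↔ SectorHC ∧ HonestOffSector`: the honest part is precisely "HC minus full HC on the sector".
[folklore] -/
theorem hodgeConjecture_iff_sectorHC_and_honest :
    _root_.HodgeConjecture ↔ SectorHC ∧ HonestOffSector :=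
  ⟨fun h ↦ ⟨sectorHC_of_hodgeConjecture h, fun _ ↦ h⟩, fun h ↦ h.2 h.1⟩

/-- Even the honest part is refutable only through a formal `¬ HC`: its negation is "full HC on the
sector AND a failure of HC" (necessarily elsewhere). [folklore] -/
theorem not_honestOffSector_iff : ¬ HonestOffSector ↔ SectorHC ∧ ¬ _root_.HodgeConjecture :=
  Classical.not_imp

/-- The frame implies its honest part (the converse needs `Calibration`). [folklore] -/
theorem honestOffSector_of_sectorComplement (h : SectorComplement) : HonestOffSector :=
  (sectorComplement_iff_honest_and_calibration.1 h).1

/-- CALIBRATION FROM ITS FOUR BINDERS (all printed theorems; none is a tree theorem yet):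
`hL` Lefschetz (1,1) for smooth projective `N`-folds [Voisin I, Thm. 11.30]; `hHL` the hard-Lefschetz
reduction "for `N < 2p`, HC in codimension `N - p` ⟹ HC in codimension `p`" [Voisin I, Thm. 6.25 +
Rem. 6.27, §11.3]; `hM` Hodge models [Serre GAGA §2 + de Rham + Hodge]; `hBMM` HC in DEGREE 4 on
6-dimensional compact arithmetic ball quotients [Bergeron–Millson–Moeglin, arXiv:1306.1515, Cor. 2 at
(p, n) = (6, 2): n ∉ ]p/3, 2p/3[]. With `MiddleDegreeStep` they give full HC on the sector: degree 0 by
`hodgeConjectureFor_codim_zero`, 2 by `hL`, 4 on 6-folds by `hBMM`, the middle degree by the target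
(whose own degree-`2m` hypothesis is `hL` at m = 1 and `hBMM` at m = 2), the upper degrees by `hHL`.
The m = 1 half is the route's support item `FourfoldHodge`; the m = 2 half shows the frame ALSO hides
BMM Cor. 2 (degree 4 on 6-ball quotients), which is not an item of the route. [folklore] -/
theorem calibration_of_binders
    (hL : ∀ (N : ℕ) (X : SchemeOver ℂ), IsSmoothProjective N X →
      ∀ c : complexBetti X (2 * 1), IsRationalClass c → IsOfHodgeType N X (2 * 1) 1 1 c →
        c ∈ algebraicClasses X 1)
    (hHL : ∀ (N : ℕ) (X : SchemeOver ℂ), IsSmoothProjective N X → ∀ p : ℕ, N < 2 * p →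
      (∀ a : complexBetti X (2 * (N - p)), IsRationalClass a →
        IsOfHodgeType N X (2 * (N - p)) (N - p) (N - p) a → a ∈ algebraicClasses X (N - p)) →
      ∀ c : complexBetti X (2 * p), IsRationalClass c → IsOfHodgeType N X (2 * p) p p c →
        c ∈ algebraicClasses X p)
    (hM : ∀ (N : ℕ) (X : SchemeOver ℂ), IsSmoothProjective N X → Nonempty (HodgeModel N X))
    (hBMM : ∀ X : SchemeOver ℂ, Nonempty (UnitaryBallQuotientDatum (2 * (2 + 1)) X) →
      ∀ a : complexBetti X (2 * 2), IsRationalClass a → IsOfHodgeType (2 * (2 + 1)) X (2 * 2) 2 2 a →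
        a ∈ algebraicClasses X 2) :
    Calibration := by
  intro hMid m X h1 h2 hD
  obtain ⟨D⟩ := id hD
  have hX : IsSmoothProjective (2 * (m + 1)) X := D.isSmoothProjective
  refine ⟨hM _ X hX, fun p c hc hH ↦ ?_⟩
  obtain rfl | rfl : m = 1 ∨ m = 2 := by omega
  · -- fourfolds
    have low : ∀ k : ℕ, k ≤ 1 → ∀ a : complexBetti X (2 * k), IsRationalClass a →
        IsOfHodgeType (2 * (1 + 1)) X (2 * k) k k a → a ∈ algebraicClasses X k := by
      intro k hk
      interval_cases k
      · exact fun a _ _ ↦ hodgeConjectureFor_codim_zero a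
      · exact hL _ X hX
    rcases Nat.lt_or_ge p 3 with hp | hp
    · interval_cases p
      · exact hodgeConjectureFor_codim_zero c
      · exact hL _ X hX c hc hH
      · exact hMid 1 X le_rfl (by norm_num) hD (hL _ X hX) c hc hH
    · exact hHL _ X hX p (by omega) (low (2 * (1 + 1) - p) (by omega)) c hc hH
  · -- sixfolds
    have low : ∀ k : ℕ, k ≤ 2 → ∀ a : complexBetti X (2 * k), IsRationalClass a →
        IsOfHodgeType (2 * (2 + 1)) X (2 * k) k k a → a ∈ algebraicClasses X k := by
      intro k hk
      interval_cases k
      · exact fun a _ _ ↦ hodgeConjectureFor_codim_zero a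
      · exact hL _ X hX
      · exact hBMM X hD
    rcases Nat.lt_or_ge p 4 with hp | hp
    · interval_cases p
      · exact hodgeConjectureFor_codim_zero c
      · exact hL _ X hX c hc hH
      · exact hBMM X hD c hc hH
      · exact hMid 2 X (by norm_num) le_rfl hD (hBMM X hD) c hc hH
    · exact hHL _ X hX p (by omega) (low (2 * (2 + 1) - p) (by omega)) c hc hH

/-- Hence, modulo the four binders, the crux IS its honest part: `SectorComplement ↔ HonestOffSector`.
[folklore] -/
theorem sectorComplement_iff_honest_of_calibration (hC : Calibration) :
    SectorComplement ↔ HonestOffSector :=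
  ⟨honestOffSector_of_sectorComplement, fun h ↦ sectorComplement_iff_honest_and_calibration.2 ⟨h, hC⟩⟩

/-! ## 6. Universality reading: ball quotients as a universal test family (cycle 2) -/

/-- `SectorComplement ↔ (¬ HC → ¬ MiddleDegreeStep)`: "if HC fails ANYWHERE (any dimension, any X, any
degree), then middle-degree propagation already fails on some compact arithmetic ball quotient of
dimension 4 or 6". Nobody believes ball quotients are universal for this reason; the statement is
believed exactly because HC is. [folklore] -/
theorem sectorComplement_iff_contrapositive :
    SectorComplement ↔ (¬ _root_.HodgeConjecture → ¬ MiddleDegreeStep) :=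
  ⟨fun h hHC hM ↦ hHC (h hM), fun h hM ↦ Classical.by_contradiction fun hHC ↦ h hHC hM⟩

/-- The same for the honest part: any failure of HC is mirrored by a failure of FULL HC on the sector.
[folklore] -/
theorem honestOffSector_iff_contrapositive :
    HonestOffSector ↔ (¬ _root_.HodgeConjecture → ¬ SectorHC) :=
  ⟨fun h hHC hS ↦ hHC (h hS), fun h hS ↦ Classical.by_contradiction fun hHC ↦ h hHC hS⟩

/-! ## 7. Where a kill could come from: the dichotomy of a formal `¬ HC` (cycle 2) -/

/-- An HONEST counterexample to the formal summit: a smooth projective `X` with a rational class of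
Hodge type `(p,p)` outside `algebraicClasses X p`. [folklore] -/
def HonestCounterexample : Prop :=
  ∃ (n : ℕ) (X : SchemeOver ℂ) (p : ℕ) (c : complexBetti X (2 * p)), IsSmoothProjective n X ∧
    IsRationalClass c ∧ IsOfHodgeType n X (2 * p) p p c ∧ c ∉ algebraicClasses X p

/-- A JUNK counterexample to the formal summit: a smooth projective `X` WITHOUT Hodge model (the
anti-vacuity conjunct `Nonempty (HodgeModel n X)` of `HodgeConjectureFor` failing). [folklore] -/
def ModellessVariety : Prop :=
  ∃ (n : ℕ) (X : SchemeOver ℂ), IsSmoothProjective n X ∧ IsEmpty (HodgeModel n X)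

/-- DICHOTOMY: a formal `¬ HC` is a model-less smooth projective variety or an honest non-algebraic
Hodge class — nothing else. [folklore] -/
theorem not_hodgeConjecture_iff_modelless_or_honest :
    ¬ _root_.HodgeConjecture ↔ ModellessVariety ∨ HonestCounterexample := by
  constructor
  · intro h
    by_contra h'
    refine h fun n X hX ↦ ⟨?_, fun p c hc hH ↦ ?_⟩
    · by_contra hA
      exact h' (Or.inl ⟨n, X, hX, not_nonempty_iff.1 hA⟩)
    · by_contra hc'
      exact h' (Or.inr ⟨n, X, p, c, hX, hc, hH, hc'⟩)
  · rintro (⟨n, X, hX, hE⟩ | ⟨n, X, p, c, hX, hc, hH, hc'⟩) hHC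
    · exact not_nonempty_iff.2 hE (hHC hX).1
    · exact hc' ((hHC hX).2 p c hc hH)

/-- The junk branch is closed by the tree's named fact `nonempty_hodgeModel` (Serre GAGA §2 + de Rham's
theorem + the Hodge decomposition; assembled from three finer facts in
`HodgeModelExistenceProofs.nonempty_hodgeModel_of`). [cite: SerreGAGA1956, §2] -/
theorem not_modellessVariety_of_fact (hF : ∀ (n : ℕ) (X : SchemeOver ℂ), nonempty_hodgeModel n X) :
    ¬ ModellessVariety := by
  rintro ⟨n, X, hX, hE⟩
  exact not_nonempty_iff.2 hE (hF n X hX)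

/-- Modulo that fact, a formal `¬ HC` is an honest counterexample. [folklore] -/
theorem not_hodgeConjecture_iff_honest_of_fact
    (hF : ∀ (n : ℕ) (X : SchemeOver ℂ), nonempty_hodgeModel n X) :
    ¬ _root_.HodgeConjecture ↔ HonestCounterexample := by
  rw [not_hodgeConjecture_iff_modelless_or_honest]
  exact ⟨fun h ↦ h.resolve_left (not_modellessVariety_of_fact hF), Or.inr⟩

/-- EXACT CONTENT OF A KILL, modulo model existence: prove the route target AND exhibit a genuine
non-algebraic rational Hodge class on some smooth projective variety. [folklore] -/
theorem not_sectorComplement_iff_of_fact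
    (hF : ∀ (n : ℕ) (X : SchemeOver ℂ), nonempty_hodgeModel n X) :
    ¬ SectorComplement ↔ MiddleDegreeStep ∧ HonestCounterexample := by
  rw [not_sectorComplement_iff, not_hodgeConjecture_iff_honest_of_fact hF]

/-- VACUITY ROUTE 1 for the target: if NO `X` carries a datum in dimensions 4 and 6, the target holds
vacuously (the route would be meaningless) — but the crux then literally IS the summit
(`sectorComplement_iff_of_middleDegreeStep`): no kill. Mathematically false (Kottwitz/Clozel; BMM Part 2
§1), and no `False` is derivable from the datum's fields (docblock §7). [folklore] -/
theorem middleDegreeStep_of_forall_isEmpty_datum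
    (h : ∀ (m : ℕ) (X : SchemeOver ℂ), 1 ≤ m → m ≤ 2 →
      IsEmpty (UnitaryBallQuotientDatum (2 * (m + 1)) X)) :
    MiddleDegreeStep :=
  fun m X h1 h2 hD ↦ (not_nonempty_iff.2 (h m X h1 h2) hD).elim

/-- VACUITY ROUTE 2 for the target: if data-carrying `X` had NO Hodge model, the target would hold
vacuously, because its conclusion's hypothesis `IsOfHodgeType … c` is `∃ A : HodgeModel (2(m+1)) X, …`.
[folklore] -/
theorem middleDegreeStep_of_modelless_sector
    (h : ∀ (m : ℕ) (X : SchemeOver ℂ), 1 ≤ m → m ≤ 2 →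
      Nonempty (UnitaryBallQuotientDatum (2 * (m + 1)) X) → IsEmpty (HodgeModel (2 * (m + 1)) X)) :
    MiddleDegreeStep := by
  intro m X h1 h2 hD _ c _ hH
  obtain ⟨A, -⟩ := hH
  exact ((h m X h1 h2 hD).false A).elim

/-- THE ONE JUNK WORLD THAT KILLS THE CRUX: an inhabited but model-less sector. There the target is
vacuously true (route 2) and HC fails at the datum's own `isSmoothProjective` (model conjunct), so
`¬ SectorComplement`. Recorded to show exactly which formal defect a cheap kill would need.
[folklore] -/
theorem not_sectorComplement_of_inhabited_modelless_sector
    (h : ∀ (m : ℕ) (X : SchemeOver ℂ), 1 ≤ m → m ≤ 2 →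
      Nonempty (UnitaryBallQuotientDatum (2 * (m + 1)) X) → IsEmpty (HodgeModel (2 * (m + 1)) X))
    (hinh : ∃ (m : ℕ) (X : SchemeOver ℂ), 1 ≤ m ∧ m ≤ 2 ∧
      Nonempty (UnitaryBallQuotientDatum (2 * (m + 1)) X)) :
    ¬ SectorComplement := by
  obtain ⟨m, X, h1, h2, hD⟩ := hinh
  refine not_sectorComplement_iff.2 ⟨middleDegreeStep_of_modelless_sector h, ?_⟩
  obtain ⟨D⟩ := id hD
  exact (not_hodgeConjecture_iff_modelless_or_honest).2
    (Or.inl ⟨_, X, D.isSmoothProjective, h m X h1 h2 hD⟩)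

/-- … and that junk world is excluded by the named fact: every data-carrying `X` HAS a Hodge model.
[cite: SerreGAGA1956, §2] -/
theorem nonempty_hodgeModel_on_sector (hF : ∀ (n : ℕ) (X : SchemeOver ℂ), nonempty_hodgeModel n X)
    {m : ℕ} {X : SchemeOver ℂ} (hD : Nonempty (UnitaryBallQuotientDatum (2 * (m + 1)) X)) :
    Nonempty (HodgeModel (2 * (m + 1)) X) := by
  obtain ⟨D⟩ := hD
  exact hF _ X D.isSmoothProjective

/-- So, modulo the fact, the hypothesis of `not_sectorComplement_of_inhabited_modelless_sector` is
itself refuted as soon as the sector is inhabited. [folklore] -/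
theorem no_modelless_inhabited_sector_of_fact
    (hF : ∀ (n : ℕ) (X : SchemeOver ℂ), nonempty_hodgeModel n X)
    (hinh : ∃ (m : ℕ) (X : SchemeOver ℂ), 1 ≤ m ∧ m ≤ 2 ∧
      Nonempty (UnitaryBallQuotientDatum (2 * (m + 1)) X)) :
    ¬ ∀ (m : ℕ) (X : SchemeOver ℂ), 1 ≤ m → m ≤ 2 →
      Nonempty (UnitaryBallQuotientDatum (2 * (m + 1)) X) → IsEmpty (HodgeModel (2 * (m + 1)) X) := by
  intro h
  obtain ⟨m, X, h1, h2, hD⟩ := hinh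
  exact not_nonempty_iff.2 (h m X h1 h2 hD) (nonempty_hodgeModel_on_sector hF hD)

/-! ## 8. The general pattern behind every sector frame (cycle 2) -/

/-- For ANY target `T`, the frame `T → HC` fails iff `T` holds and the formal summit fails. Every
sector frame in the summit's route files has this shape; none is refutable short of a formal `¬ HC`.
[folklore] -/
theorem not_frame_iff (T : Prop) : ¬ (T → _root_.HodgeConjecture) ↔ T ∧ ¬ _root_.HodgeConjecture :=
  Classical.not_imp

/-- … and every such frame is a corollary of the summit. [folklore] -/
theorem frame_of_hodgeConjecture (T : Prop) (h : _root_.HodgeConjecture) : T → _root_.HodgeConjecture :=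
  fun _ ↦ h

/-- Frames are antitone in the target: a frame with a STRONGER target is WEAKER. In particular
`SectorComplement → HonestOffSector` (target `SectorHC` is stronger than `MiddleDegreeStep`), and a
refutation of the honest frame refutes this crux, not conversely. [folklore] -/
theorem frame_antitone {T T' : Prop} (hTT' : T' → T) :
    (T → _root_.HodgeConjecture) → (T' → _root_.HodgeConjecture) :=
  fun h hT' ↦ h (hTT' hT')

end Summit.HodgeConjecture.HodgeConjecture.Cruxes.SectorComplement.Disproof

/-!
# Part II — Disproof of `NikulinTwinTransport.SectorComplement` (crux stmt-HodgeConjecture-13684) — findings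

Crux (route `NikulinTwinTransport`, rank 9, the declared sector frame, binder `h₂` of `closes`):
`SectorComplement : Prop := SquareHodgeOfSqrtTwo → _root_.HodgeConjecture`, where the SECTOR
`Σ := SquareHodgeOfSqrtTwo` (stmt-HodgeConjecture-13680) is `HodgeConjectureFor 4 (S ⊗ S)` for every K3-type
`S` (smooth projective of dimension 2, `H¹(𝒪) = 0`, a nowhere-vanishing holomorphic 2-form on a Hodge model)
carrying RM data `e` (rational, type-preserving, cup-self-adjoint, kills `NS := algebraicClasses S 1`,
`e² = 2` on `NS^⊥`, `End`-exactness `f = a + b e` on `NS^⊥`).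

## Verdict of cycle 1 (cdisprove seat refuter-cdisprove-stmt-HodgeConjecture-13684-0, 2026-08-16): NO KILL.

Everything below is kernel-checked and sorry-free (`lean check` rc 0); the landable part is filed on the lane
`Theorems/SectorComplement/Negative/NikulinTwinTransportKillShape.lean` (`--supports` 13684; see NOTES/HANDOFF for
the proposal id), next to the prover's bookkeeping file `Theorems/NikulinTwinTransportSectorComplement.lean`
(p84060: `HC → SectorComplement`, `HC → Σ` via `IsSmoothProjective.tensor_holds`, `¬SectorComplement ↔ Σ ∧ ¬HC`,
`SectorComplement ↔ ¬Σ ∨ HC`, `HC ↔ Σ ∧ SectorComplement`), which this part CITES rather than re-proves (§N1).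

* §N1 FRAME ≡ SUMMIT MINUS SECTOR (p84060, aliased): a kill is exactly `Σ ∧ ¬HC_formal` — the refuter would have
  to PROVE the open sector AND refute the formal Hodge conjecture.
* §N2 LOAD-BEARING ANALYSIS: the crux has ONE hypothesis, `Σ`; dropping it gives `SectorComplementWithoutSector :=
  HC` verbatim (`withoutSector_iff : … ↔ Σ ∧ SectorComplement`). A `sectorComplement_false_without_sector` theorem
  would be `¬HC`: not available, not expected. No `_false_without_` lemma exists for this crux.
* §N3 EXACT KILL CONTENT: `¬SectorComplement ↔ Σ ∧ (ModellessVariety ∨ HonestCounterexample)` (Part I's dichotomy of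
  a formal `¬HC`, reused), and modulo the named fact `nonempty_hodgeModel`: `¬SectorComplement ↔ Σ ∧ HonestCounterexample`
  — a genuine non-algebraic rational Hodge class on some smooth projective variety, PLUS the whole sector.
* §N4 ANATOMY OF Σ — NO HIDDEN CALIBRATION (contrast Part I §5): `Σ ↔ SectorHC` where `SectorHC := ∀ S, K3Hyp S →
  (∃ e, RMData S e) → HodgeConjectureFor 4 (S ⊗ S)` is FULL HC on the sector (model conjunct + every codimension
  p = 0…4 on `S ⊗ S`); so `SectorComplement ↔ (SectorHC → HC)` is already the honest "HC off the sector". The Σ-half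
  of a kill therefore needs Hodge models of K3 squares (`nonempty_hodgeModel_square_of_sigma`: in the tree a NAMED
  FACT, i.e. a hypothesis) and the cycle conjecture on `S ⊗ S` in codimensions 1 (Lefschetz (1,1) on a fourfold),
  2 (the RM class, all of `End_Hdg H²(S)`, the Künneth middle), 3, 4 — none deliverable here. Σ is unprovable in
  the tree even before its open mathematical content is reached.
* §N5 JUNK WORLDS. (a) THE ONE THAT KILLS: `EmptySector ∧ ModellessVariety → ¬SectorComplement` (no formal K3-type
  surface at all, so Σ is vacuous, plus one smooth projective variety without Hodge model, so formal HC fails at its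
  anti-vacuity conjunct). Leg 2 is excluded by `nonempty_hodgeModel` (Part I `not_modellessVariety_of_fact`); leg 1 is
  excluded modulo the route's OWN crux `K3PeriodSurjective` (stmt-HodgeConjecture-15154) applied to the explicit
  projective period vector of `Literature.AlgebraicGeometry.Surfaces.exists_k3PeriodVector_projective`
  (`not_emptySector_of_k3PeriodSurjective`); and in an empty sector the crux is literally the summit anyway
  (`sectorComplement_iff_hc_of_emptySector`). (b) THE ONE THAT PROVES THE CRUX: `ModellessSquare` (a K3-type `S` with
  RM data whose square has no Hodge model) gives `¬Σ`, hence `SectorComplement` vacuously AND `¬HC_formal`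
  (`sectorComplement_and_not_hc_of_modellessSquare`); excluded by the same fact via `IsSmoothProjective.tensor_holds`.
  Junk in the square's models only ever helps the POSITIVE side of this item. (c) Vacuity of the RM data (no `e`
  anywhere) makes Σ vacuous and the crux ≡ HC (`sectorComplement_iff_hc_of_noRMData`) — mathematically false
  (van Geemen–Schütt 2023 Thm 3.10: 8-dimensional families of K3s with RM by `ℚ(√2)`), formally out of reach
  (period point of an RM-√2 K3 + computation of `End_Hdg`).
* §N6 SMALL MODEL `e = 0`: `RMData S 0 ↔ NS(S)^⊥ = 0` (`rmData_zero_iff`): the degenerate endomorphism is admissible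
  exactly on K3-type surfaces whose `H²` is cup-orthogonally exhausted by algebraic classes ("ρ = 22"; on paper none,
  `NS^⊥ ⊇ H^{2,0} ≠ 0`). So Σ CONTAINS the unintended slice `PerpTrivialSliceHC` (HC for `S ⊗ S` whenever `NS(S)^⊥ = 0`,
  `perpTrivialSlice_of_sigma`) — harmless: HC-implied (`perpTrivialSlice_of_hc`) and the frame is antitone in Σ.
  Not a misstatement of 13680 in the refutable sense; recorded so nobody mistakes `e = 0` for a lever.
* §N7 NATURAL STRENGTHENINGS / MUTATIONS — none refutable: dropping `End`-exactness (`SigmaAllRM`), dropping the RM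
  data altogether (`SigmaAllK3Squares` = HC for every K3 square), or shrinking to the slice of §N6 gives sectors
  `T` with `HC → T`, hence frames `T → HC` that are corollaries of HC and fail iff `T ∧ ¬HC` (Part I `not_frame_iff`);
  frames are ANTITONE in the sector (`frame_antitone`; the stronger sector gives the weaker frame): from
  `SigmaAllK3Squares → SigmaAllRM → Σ → Slice` one gets
  `(Slice → HC) → (Σ → HC) → (SigmaAllRM → HC) → (SigmaAllK3Squares → HC)` (`frame_chain`), and both ends of the chain
  fail iff their sector holds while formal HC fails (`not_weakestFrame_iff`, `not_strongestFrame_iff`). Only mutating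
  the CONSEQUENT (HC ↦ something false) could produce a refutable statement, and that is not this item.
* §N8 UNIVERSALITY READING: `SectorComplement ↔ (¬HC → ¬Σ)` — "if HC fails anywhere, it already fails on the square of
  some K3-type surface with exact RM by √2". Believed only because HC is; conjecture-grade as filed.

WHY IT RESISTS (one line): the crux is `HC ∖ Σ` as an implication whose conclusion IS the formal summit; its negation
is `Σ ∧ ¬HC_formal`; `¬HC_formal` has neither an honest witness (open; nothing in print for the RATIONAL projective HC —
Atiyah–Hirzebruch/Kollár/Totaro are integral, Zucker/Voisin are Kähler, all catalogued in `Literature/Barriers/HodgeConjecture/`)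
nor a junk one (Part I §7 audit of the definitional stack; `nonempty_hodgeModel`), and `Σ` is not even formally
provable (models of K3 squares are a named fact). Literature/negatives checked this cycle: `ledger negatives --problem
HodgeConjecture` (see NOTES), barrier catalogue names (79 files), TRIAGE-r1-1/2 (13684) and the k1/k2 ideator memos
(0 cards by design; Markman 2025 closes the item's own `why_might_fail` example "Weil classes on abelian fourfolds").

-- Targets: none (payload.stuck_stubs = [], payload.targets = [], no line picked for 13684: PICKED.md §13684 "(none)").
-/

namespace Summit.HodgeConjecture.HodgeConjecture.Cruxes.SectorComplement.Disproof.NikulinTwinTransport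

open scoped Manifold
open Summit.HodgeConjecture.HodgeConjecture.Theses.NikulinTwinTransport
open Summit.HodgeConjecture.HodgeConjecture.Theorems
open Literature.AlgebraicGeometry.HodgeTheory Literature.AlgebraicGeometry.Motives
open Literature.AlgebraicTopology.SingularHomology (cupProduct)

/-! ## §N0 Abbreviations for the sector's hypotheses (workfile-only `def`s) -/

/-- The route's unfolded `IsK3Surface S`: smooth projective surface, `H¹(𝒪_S) = 0`, and a nowhere-vanishing
2-form holomorphic in the charts of some Hodge model. [folklore] -/
def K3Hyp (S : SchemeOver ℂ) : Prop :=
  IsSmoothProjective 2 S ∧ Subsingleton (structureSheafCohomology S.left 1) ∧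
    ∃ (A : HodgeModel 2 S) (η : Literature.Geometry.Kaehler.MForm 𝓘(ℝ, A.model) A.carrier ℂ 2),
      Literature.Geometry.Kaehler.IsHolomorphicInCharts η ∧ ∀ x, η x ≠ 0

/-- `x ⊥ NS(S)`: cup-orthogonality to every algebraic divisor class. [folklore] -/
def PerpNS (S : SchemeOver ℂ) (x : complexBetti S (2 * 1)) : Prop :=
  ∀ d ∈ algebraicClasses S 1, cupProduct (rfl : 2 * 1 + 2 * 1 = 2 * 2) x d = 0

/-- The first five RM hypotheses of the sector on `e` (rational, type-preserving, self-adjoint, kills `NS`,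
`e² = 2` on `NS^⊥`). [folklore] -/
def RMCore (S : SchemeOver ℂ) (e : complexBetti S (2 * 1) →ₗ[ℂ] complexBetti S (2 * 1)) : Prop :=
  (∀ x, IsRationalClass x → IsRationalClass (e x)) ∧
  (∀ (i j : ℕ) x, IsOfHodgeType 2 S (2 * 1) i j x → IsOfHodgeType 2 S (2 * 1) i j (e x)) ∧
  (∀ x y : complexBetti S (2 * 1),
    cupProduct (rfl : 2 * 1 + 2 * 1 = 2 * 2) (e x) y = cupProduct (rfl : 2 * 1 + 2 * 1 = 2 * 2) x (e y)) ∧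
  (∀ d ∈ algebraicClasses S 1, e d = 0) ∧
  (∀ x : complexBetti S (2 * 1), PerpNS S x → e (e x) = (2 : ℂ) • x)

/-- The sixth RM hypothesis: `End`-exactness (`End_Hdg(T)` is spanned by `1, e` on `NS^⊥`). [folklore] -/
def EndExact (S : SchemeOver ℂ) (e : complexBetti S (2 * 1) →ₗ[ℂ] complexBetti S (2 * 1)) : Prop :=
  ∀ f : complexBetti S (2 * 1) →ₗ[ℂ] complexBetti S (2 * 1),
    (∀ x, IsRationalClass x → IsRationalClass (f x)) →
    (∀ (i j : ℕ) x, IsOfHodgeType 2 S (2 * 1) i j x → IsOfHodgeType 2 S (2 * 1) i j (f x)) →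
    (∀ d ∈ algebraicClasses S 1, f d = 0) →
    (∀ x : complexBetti S (2 * 1), ∀ d ∈ algebraicClasses S 1,
      cupProduct (rfl : 2 * 1 + 2 * 1 = 2 * 2) (f x) d = 0) →
    ∃ a b : ℚ, ∀ x : complexBetti S (2 * 1), PerpNS S x → f x = (a : ℂ) • x + (b : ℂ) • e x

/-- All six RM hypotheses. [folklore] -/
def RMData (S : SchemeOver ℂ) (e : complexBetti S (2 * 1) →ₗ[ℂ] complexBetti S (2 * 1)) : Prop :=
  RMCore S e ∧ EndExact S e

/-- FULL HC ON THE SECTOR: `HodgeConjectureFor 4 (S ⊗ S)` for every K3-type `S` admitting RM data. [folklore] -/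
def SectorHC : Prop :=
  ∀ S : SchemeOver ℂ, K3Hyp S → (∃ e, RMData S e) →
    HodgeConjectureFor 4 (CategoryTheory.MonoidalCategoryStruct.tensorObj S S)

/-- The sector IS full HC on the sector (the `∀ e` of Σ does not occur in its conclusion). [folklore] -/
theorem squareHodgeOfSqrtTwo_iff_sectorHC : SquareHodgeOfSqrtTwo ↔ SectorHC := by
  constructor
  · rintro hSig S hS ⟨e, ⟨h1, h2, h3, h4, h5⟩, h6⟩
    exact hSig S hS e h1 h2 h3 h4 h5 h6
  · intro h S hS e h1 h2 h3 h4 h5 h6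
    exact h S hS ⟨e, ⟨h1, h2, h3, h4, h5⟩, h6⟩

/-! ## §N1 The frame is the summit minus the sector (p84060, cited) -/

/-- `¬SectorComplement ↔ Σ ∧ ¬HC` (p84060). [folklore] -/
theorem not_sectorComplement_iff : ¬ SectorComplement ↔ SquareHodgeOfSqrtTwo ∧ ¬ _root_.HodgeConjecture :=
  nikulinTwinTransport_not_sectorComplement_iff

/-- Any kill of this crux is a disproof of the FORMAL summit (p84060, `HC → SectorComplement`). [folklore] -/
theorem not_hodgeConjecture_of_not_sectorComplement (h : ¬ SectorComplement) : ¬ _root_.HodgeConjecture :=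
  fun hHC ↦ h (nikulinTwinTransport_sectorComplement_of_hodgeConjecture hHC)

/-- … and must also PROVE the sector (p84060). [folklore] -/
theorem squareHodgeOfSqrtTwo_of_not_sectorComplement (h : ¬ SectorComplement) : SquareHodgeOfSqrtTwo :=
  (not_sectorComplement_iff.1 h).1

/-- The frame in honest form: `SectorComplement ↔ (full HC on the sector → HC)`. [folklore] -/
theorem sectorComplement_iff_sectorHC_imp : SectorComplement ↔ (SectorHC → _root_.HodgeConjecture) := by
  rw [← squareHodgeOfSqrtTwo_iff_sectorHC]; rfl

/-! ## §N2 Load-bearing analysis: the single hypothesis -/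

/-- The crux with its only hypothesis `Σ` dropped: literally the summit. [folklore] -/
def SectorComplementWithoutSector : Prop :=
  _root_.HodgeConjecture

/-- `SectorComplementWithoutSector ↔ Σ ∧ SectorComplement` (p84060): the hypothesis is load-bearing exactly to the
extent that Σ is not yet a theorem; `sectorComplement_false_without_sector` would be `¬HC` (unavailable). [folklore] -/
theorem withoutSector_iff : SectorComplementWithoutSector ↔ SquareHodgeOfSqrtTwo ∧ SectorComplement :=
  nikulinTwinTransport_hodgeConjecture_iff_sector_and_complement

/-! ## §N3 Exact content of a kill -/

/-- `¬SectorComplement ↔ Σ ∧ (ModellessVariety ∨ HonestCounterexample)` (Part I's dichotomy of a formal `¬HC`).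
[folklore] -/
theorem not_sectorComplement_iff_modelless_or_honest :
    ¬ SectorComplement ↔ SquareHodgeOfSqrtTwo ∧ (ModellessVariety ∨ HonestCounterexample) := by
  rw [not_sectorComplement_iff, not_hodgeConjecture_iff_modelless_or_honest]

/-- Modulo `nonempty_hodgeModel`: a kill is the whole sector AND an honest non-algebraic rational Hodge class.
[cite: SerreGAGA1956, §2] -/
theorem not_sectorComplement_iff_of_fact (hF : ∀ (n : ℕ) (X : SchemeOver ℂ), nonempty_hodgeModel n X) :
    ¬ SectorComplement ↔ SquareHodgeOfSqrtTwo ∧ HonestCounterexample := by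
  rw [not_sectorComplement_iff, not_hodgeConjecture_iff_honest_of_fact hF]

/-! ## §N4 What the Σ-half of a kill must deliver -/

/-- Hodge models of K3 squares on the sector — in the tree a named fact, never a theorem. [folklore] -/
theorem nonempty_hodgeModel_square_of_sigma (hSig : SquareHodgeOfSqrtTwo) {S : SchemeOver ℂ} (hS : K3Hyp S)
    (he : ∃ e, RMData S e) : Nonempty (HodgeModel 4 (CategoryTheory.MonoidalCategoryStruct.tensorObj S S)) :=
  (squareHodgeOfSqrtTwo_iff_sectorHC.1 hSig S hS he).1

/-- The cycle conjecture on `S ⊗ S` in EVERY codimension `p` on the sector. [folklore] -/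
theorem cycles_square_of_sigma (hSig : SquareHodgeOfSqrtTwo) {S : SchemeOver ℂ} (hS : K3Hyp S)
    (he : ∃ e, RMData S e) (p : ℕ)
    (c : complexBetti (CategoryTheory.MonoidalCategoryStruct.tensorObj S S) (2 * p)) (hc : IsRationalClass c)
    (hH : IsOfHodgeType 4 (CategoryTheory.MonoidalCategoryStruct.tensorObj S S) (2 * p) p p c) :
    c ∈ algebraicClasses (CategoryTheory.MonoidalCategoryStruct.tensorObj S S) p :=
  (squareHodgeOfSqrtTwo_iff_sectorHC.1 hSig S hS he).2 p c hc hH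

/-! ## §N5 Junk worlds -/

/-- No formal K3-type surface at all. Mathematically false; the tree constructs none. [folklore] -/
def EmptySector : Prop :=
  ∀ S : SchemeOver ℂ, ¬ K3Hyp S

/-- No RM data anywhere (weaker junk: K3-type surfaces may exist, none carries an admissible `e`). [folklore] -/
def NoRMData : Prop :=
  ∀ S : SchemeOver ℂ, K3Hyp S → ∀ e, ¬ RMData S e

/-- A K3-type `S` with RM data whose square has no Hodge model. [folklore] -/
def ModellessSquare : Prop :=
  ∃ S : SchemeOver ℂ, K3Hyp S ∧ (∃ e, RMData S e) ∧
    IsEmpty (HodgeModel 4 (CategoryTheory.MonoidalCategoryStruct.tensorObj S S))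

/-- In an empty sector the crux IS the summit. [folklore] -/
theorem sectorComplement_iff_hc_of_emptySector (h : EmptySector) : SectorComplement ↔ _root_.HodgeConjecture :=
  ⟨fun hS ↦ hS fun S hS ↦ absurd hS (h S), fun hHC _ ↦ hHC⟩

/-- Likewise without RM data. [folklore] -/
theorem sectorComplement_iff_hc_of_noRMData (h : NoRMData) : SectorComplement ↔ _root_.HodgeConjecture :=
  ⟨fun hS ↦ hS (squareHodgeOfSqrtTwo_iff_sectorHC.2 fun S hS ⟨e, he⟩ ↦ absurd he (h S hS e)),
    fun hHC _ ↦ hHC⟩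

/-- THE JUNK WORLD THAT KILLS THE CRUX: vacuous sector (no RM data) + one model-less smooth projective variety.
[folklore] -/
theorem not_sectorComplement_of_noRMData_of_modelless (h : NoRMData) (hj : ModellessVariety) :
    ¬ SectorComplement := by
  rw [sectorComplement_iff_hc_of_noRMData h, not_hodgeConjecture_iff_modelless_or_honest]
  exact Or.inl hj

/-- An empty sector has no RM data a fortiori. [folklore] -/
theorem noRMData_of_emptySector (h : EmptySector) : NoRMData :=
  fun S hS _ _ ↦ h S hS

/-- Leg 1 excluded modulo the route's own crux `K3PeriodSurjective` (stmt-HodgeConjecture-15154), via the explicit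
projective period vector `(e₁ + f₁) + i (e₂ + f₂)`, `v = e₃ + f₃`. [cite: Huybrechts2016K3, Ch. 6 Rem. 3.3] -/
theorem not_emptySector_of_k3PeriodSurjective (h : K3PeriodSurjective) : ¬ EmptySector := by
  obtain ⟨x, v, hxx, hxpos, hvx, hvv⟩ :=
    Literature.AlgebraicGeometry.Surfaces.exists_k3PeriodVector_projective
  obtain ⟨S, hS, -⟩ := h x hxx hxpos ⟨v, hvx, hvv⟩
  exact fun hempty ↦ hempty S hS

/-- Leg 2 excluded by the named fact (Part I). Together: modulo `nonempty_hodgeModel`, even with NO RM data the crux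
is refutable only by an honest counterexample to HC. [cite: SerreGAGA1956, §2] -/
theorem not_sectorComplement_iff_honest_of_noRMData_of_fact
    (hF : ∀ (n : ℕ) (X : SchemeOver ℂ), nonempty_hodgeModel n X) (h : NoRMData) :
    ¬ SectorComplement ↔ HonestCounterexample := by
  rw [sectorComplement_iff_hc_of_noRMData h, not_hodgeConjecture_iff_honest_of_fact hF]

/-- THE JUNK WORLD THAT PROVES THE CRUX: a model-less K3 square refutes Σ … [folklore] -/
theorem not_sigma_of_modellessSquare (h : ModellessSquare) : ¬ SquareHodgeOfSqrtTwo := by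
  rintro hSig
  obtain ⟨S, hS, he, hE⟩ := h
  exact not_nonempty_iff.2 hE (nonempty_hodgeModel_square_of_sigma hSig hS he)

/-- … hence proves the frame vacuously AND refutes the formal summit: junk in the square's models helps only the
positive side of this item. [folklore] -/
theorem sectorComplement_and_not_hc_of_modellessSquare (h : ModellessSquare) :
    SectorComplement ∧ ¬ _root_.HodgeConjecture :=
  ⟨fun hSig ↦ absurd hSig (not_sigma_of_modellessSquare h),
    nikulinTwinTransport_not_hodgeConjecture_of_not_squareHodgeOfSqrtTwo (not_sigma_of_modellessSquare h)⟩

/-- … and is excluded by the fact (`S ⊗ S` is smooth projective of dimension `2 + 2`). [cite: SerreGAGA1956, §2] -/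
theorem not_modellessSquare_of_fact (hF : ∀ (n : ℕ) (X : SchemeOver ℂ), nonempty_hodgeModel n X) :
    ¬ ModellessSquare := by
  rintro ⟨S, hS, -, hE⟩
  exact not_nonempty_iff.2 hE (hF _ _ (IsSmoothProjective.tensor_holds hS.1 hS.1))

/-! ## §N6 Small model `e = 0` and the degenerate slice of the sector -/

/-- With `e = 0`, "`e² = 2` on `NS^⊥`" holds iff `NS^⊥ = 0`. [folklore] -/
theorem rm_zero_iff_perp_trivial (S : SchemeOver ℂ) :
    (∀ x : complexBetti S (2 * 1), PerpNS S x →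
      (0 : complexBetti S (2 * 1) →ₗ[ℂ] complexBetti S (2 * 1))
        ((0 : complexBetti S (2 * 1) →ₗ[ℂ] complexBetti S (2 * 1)) x) = (2 : ℂ) • x) ↔
    ∀ x : complexBetti S (2 * 1), PerpNS S x → x = 0 := by
  refine forall_congr' fun x ↦ imp_congr_right fun _ ↦ ?_
  rw [LinearMap.zero_apply, eq_comm, smul_eq_zero]
  exact ⟨fun h ↦ h.resolve_left two_ne_zero, Or.inr⟩

/-- `RMData S 0 ↔ NS(S)^⊥ = 0` on a K3-type `S` (the other five hypotheses hold trivially for `e = 0`; the model of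
`K3Hyp` is needed only for `IsOfHodgeType.zero`). [folklore] -/
theorem rmData_zero_iff {S : SchemeOver ℂ} (hS : K3Hyp S) :
    RMData S 0 ↔ ∀ x : complexBetti S (2 * 1), PerpNS S x → x = 0 := by
  obtain ⟨A, -⟩ := hS.2.2
  constructor
  · exact fun h ↦ (rm_zero_iff_perp_trivial S).1 h.1.2.2.2.2
  · intro hperp
    refine ⟨⟨fun x _ ↦ ?_, fun i j x _ ↦ ?_, fun x y ↦ ?_, fun d _ ↦ rfl,
      (rm_zero_iff_perp_trivial S).2 hperp⟩, fun f _ _ _ _ ↦ ⟨0, 0, fun x hx ↦ ?_⟩⟩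
    · rw [LinearMap.zero_apply]; exact IsRationalClass.zero
    · rw [LinearMap.zero_apply]; exact IsOfHodgeType.zero A _ i j
    · rw [LinearMap.zero_apply, LinearMap.zero_apply, map_zero, map_zero, LinearMap.zero_apply]
    · rw [hperp x hx, map_zero, Rat.cast_zero, zero_smul, zero_smul, add_zero]

/-- The degenerate slice hidden in Σ: HC for `S ⊗ S` whenever `S` is K3-type with `NS(S)^⊥ = 0`. [folklore] -/
def PerpTrivialSliceHC : Prop :=
  ∀ S : SchemeOver ℂ, K3Hyp S → (∀ x : complexBetti S (2 * 1), PerpNS S x → x = 0) →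
    HodgeConjectureFor 4 (CategoryTheory.MonoidalCategoryStruct.tensorObj S S)

/-- Σ contains the slice (witness `e := 0`). [folklore] -/
theorem perpTrivialSlice_of_sigma (hSig : SquareHodgeOfSqrtTwo) : PerpTrivialSliceHC :=
  fun S hS hperp ↦ squareHodgeOfSqrtTwo_iff_sectorHC.1 hSig S hS ⟨0, (rmData_zero_iff hS).2 hperp⟩

/-- … and the slice is HC-implied like everything else (so it is harmless for the frame). [folklore] -/
theorem perpTrivialSlice_of_hc (hHC : _root_.HodgeConjecture) : PerpTrivialSliceHC :=
  fun _ hS _ ↦ hHC (IsSmoothProjective.tensor_holds hS.1 hS.1)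

/-! ## §N7 Natural strengthenings of the sector and the antitone law of frames -/

/-- Σ with `End`-exactness dropped: HC for squares of ALL K3-type surfaces carrying `√2`-type RM core data
(e.g. CM K3s whose CM field contains `√2`). [folklore] -/
def SigmaAllRM : Prop :=
  ∀ S : SchemeOver ℂ, K3Hyp S → (∃ e, RMCore S e) →
    HodgeConjectureFor 4 (CategoryTheory.MonoidalCategoryStruct.tensorObj S S)

/-- HC for EVERY K3 square (no endomorphism at all). [folklore] -/
def SigmaAllK3Squares : Prop :=
  ∀ S : SchemeOver ℂ, K3Hyp S → HodgeConjectureFor 4 (CategoryTheory.MonoidalCategoryStruct.tensorObj S S)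

theorem sigmaAllK3Squares_of_hc (h : _root_.HodgeConjecture) : SigmaAllK3Squares :=
  fun _ hS ↦ h (IsSmoothProjective.tensor_holds hS.1 hS.1)

theorem sigmaAllRM_of_allK3Squares (h : SigmaAllK3Squares) : SigmaAllRM :=
  fun S hS _ ↦ h S hS

theorem sigma_of_sigmaAllRM (h : SigmaAllRM) : SquareHodgeOfSqrtTwo :=
  squareHodgeOfSqrtTwo_iff_sectorHC.2 fun S hS ⟨e, he, _⟩ ↦ h S hS ⟨e, he⟩

/-- THE CHAIN OF FRAMES (antitone in the sector): stronger sector, weaker frame; every member is a corollary of HC and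
fails iff its sector holds while formal HC fails (Part I `not_frame_iff`). [folklore] -/
theorem frame_chain :
    ((PerpTrivialSliceHC → _root_.HodgeConjecture) → SectorComplement) ∧
    (SectorComplement → (SigmaAllRM → _root_.HodgeConjecture)) ∧
    ((SigmaAllRM → _root_.HodgeConjecture) → (SigmaAllK3Squares → _root_.HodgeConjecture)) :=
  ⟨frame_antitone perpTrivialSlice_of_sigma, frame_antitone sigma_of_sigmaAllRM,
    frame_antitone sigmaAllRM_of_allK3Squares⟩

/-- Even the WEAKEST frame of the chain is refutable only through a formal `¬HC`. [folklore] -/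
theorem not_weakestFrame_iff :
    ¬ (SigmaAllK3Squares → _root_.HodgeConjecture) ↔ SigmaAllK3Squares ∧ ¬ _root_.HodgeConjecture :=
  not_frame_iff _

/-- … and the STRONGEST one too. [folklore] -/
theorem not_strongestFrame_iff :
    ¬ (PerpTrivialSliceHC → _root_.HodgeConjecture) ↔ PerpTrivialSliceHC ∧ ¬ _root_.HodgeConjecture :=
  not_frame_iff _

/-! ## §N8 Universality reading -/

/-- `SectorComplement ↔ (¬HC → ¬Σ)`: squares of exact-RM-√2 K3 surfaces as a universal test family for HC.
[folklore] -/
theorem sectorComplement_iff_contrapositive :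
    SectorComplement ↔ (¬ _root_.HodgeConjecture → ¬ SquareHodgeOfSqrtTwo) :=
  ⟨fun h hHC hSig ↦ hHC (h hSig), fun h hSig ↦ Classical.by_contradiction fun hHC ↦ h hHC hSig⟩

-- Targets: none (no stuck stubs, no line picked for 13684).

end Summit.HodgeConjecture.HodgeConjecture.Cruxes.SectorComplement.Disproof.NikulinTwinTransport
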